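import Summits.FinalStateConjecture.FinalStateConjecture.Theorems.ExactKerrEndsZeroMassAdmissibleMinkowskianOfRigidity
import Literature.Geometry.Lorentzian.TranslationalKIDsOfMassZero
import HarnessLib

/-!
# Route ExactKerrEnds — crux `ZeroMassAdmissibleMinkowskian` (stmt-FinalStateConjecture-18053):
# closure from the ANALYTIC HALF of the rigid positive energy theorem alone

The crux is the rigid positive energy theorem on the admissible vacuum class (Beig–Chruściel
1996, Thm. 4.1, `m = 0`), closed conditionally from the named fact
`positive_mass_rigidity_spacetime` in `…OfRigidity.lean`. The GEOMETRIC half of that theorem is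
proved in the tree (`Literature.Geometry.Lorentzian.positive_mass_rigidity_spacetime_of_translationalKIDs`,
`SpacetimePositiveMassRigidityReductionAnalytic.lean`: completeness of the data, the developing
map of the KIDs, the universal-cover/deck-translation argument for simple connectivity, the
entire-graph and Cauchy property of complete uniformly spacelike hypersurfaces, and the
packaging as a `CauchyDevelopment` equal to `Minkowski.spacetime`), so the named fact — and the
crux — follow from the ANALYTIC half alone, the named fact
`Literature.Geometry.Lorentzian.beigChrusciel_translationalKIDs_of_admEnergy_zero`
(`TranslationalKIDsOfMassZero.lean`; Beig–Chruściel 1996, App. A with Witten's equation).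

* `zeroMassAdmissibleMinkowskian_of_analyticHalf` — the crux from the analytic half.

References: Beig–Chruściel, J. Math. Phys. 37 (1996) 1939–1961, Thm. 4.1, §4, App. A;
Witten, CMP 80 (1981); Parker–Taubes, CMP 84 (1982).
-/

-- the doubled `FinalStateConjecture.FinalStateConjecture` path component trips dupNamespace
set_option linter.dupNamespace false

noncomputable section

namespace Summit.FinalStateConjecture.FinalStateConjecture.Theorems.ExactKerrEnds

open Literature.Geometry.Lorentzian
open Summit.FinalStateConjecture.FinalStateConjecture.Theses.ExactKerrEnds (ZeroMassAdmissibleMinkowskian)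

/-- **The crux `ZeroMassAdmissibleMinkowskian` follows from the analytic half of the rigid
positive energy theorem** (Beig–Chruściel 1996, App. A: zero ADM energy forces four global
translational Killing initial data with Minkowskian Gram matrix and bounded lapse): the
geometric half being proved (`positive_mass_rigidity_spacetime_of_analyticHalf`), the crux
follows by `zeroMassAdmissibleMinkowskian_of_rigidity`.
[cite: BeigChrusciel1996, Thm. 4.1 and its proof, §4 and App. A] -/
theorem zeroMassAdmissibleMinkowskian_of_analyticHalf
    (hA : beigChrusciel_translationalKIDs_of_admEnergy_zero) : ZeroMassAdmissibleMinkowskian :=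
  zeroMassAdmissibleMinkowskian_of_rigidity (positive_mass_rigidity_spacetime_of_analyticHalf hA)

end Summit.FinalStateConjecture.FinalStateConjecture.Theorems.ExactKerrEnds

end
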